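import Mathlib
import Summits.NavierStokesRegularity.NavierStokesRegularity.Theorems.EulerZoomLiouvillePowerGaugeEulerLiouvilleSelfSimilarSlowClockPast
import Summits.NavierStokesRegularity.NavierStokesRegularity.Theorems.EulerZoomLiouvillePowerGaugeEulerLiouvilleEnergySaturationZeroRate
import HarnessLib

/-!
# SEPARABLE (RATE-ZERO) MEMBERS ARE TRIVIAL: `u(τ, x) = (T−τ)⁻¹ W(x − x₀)`, `p(τ, x) = (T−τ)⁻² P(x − x₀)` on a past sub-slab `τ < T₁` vanishes —
# weak class, no profile hypothesis, no energy bound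
# (crux `EulerZoomLiouville.PowerGaugeEulerLiouville` = stmt-NavierStokesRegularity-19832; line `logtime-breathers`, residue T4 `stub_powerClockRest`, rate `g = 0`)

Route `EulerZoomLiouville` (NavierStokesRegularity); width seat ns-ezl-w6 (cell ns-regularity-ideate, LEAD ns-typeII-p2).  Sequel of `…SelfSimilarSlowClockPast`
(rates `0 < g < 2/5`).  The rate `g = 0` of Euler's power clocks is the SEPARABLE blow-up ansatz (amplitude `(T−τ)⁻¹`, frozen shape; profile system
`W + (W·∇)W + ∇P = 0`, i.e. steady Euler with Rayleigh damping) — the «log-divergent borderline» left open by the negative-rate tame stratum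
(ns-ezl-w7 `…PowerClockNegRate`) and outside `…SelfSimilarSlowClockPast` (`g > 0`).  Its profile local energy equality (`ProfileEnergy.profile_local_energy_equality`
at `γ = 0`) has no scale-derivative term, `2∫θ|W|² = ∫(|W|²+2P)⟪W,∇θ⟫`, and this seat's rate-zero bootstrap `EnergySaturation.ae_eq_zero_of_zeroRate_loc`
(class-`ρ` data from the gauges via `OffRate.profile_energy_growth_of_gaugeA_past_rate` / `SlowClock.…_past_rate`) empties every ball.

* `SlowClock.exists_locData_past_rate` — the class-`ρ` large-scale profile data + Poisson + the LITERAL rate-`g` local energy equality, any `g ∈ [0, ½]`;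
* `SlowClock.separable_ae_eq_zero_past` — MEMBER LEVEL, ansatz form (`selfSimilarCollapse 0 T W`, `selfSimilarCollapsePressure 0 T P`, shifted by `x₀`);
* `SlowClock.separable_ae_eq_zero_past'` — the same with the plain pointwise representation `u τ x = (T − τ)⁻¹ • W (x − x₀)`,
  `p τ x = ((T − τ) ^ 2)⁻¹ * P (x − x₀)`.

WHAT THIS IS NOT: not NS, not E — a stratum of the crux CLASS 19832 on the MODEL lattice, `--supports` stmt-19832; 19832 OPEN.  Power-clock residue
(past/shifted, weak class) after this file: rates `g ∈ [2/5, 1/(2+ρ)]` and `g < 0`. [folklore; cf. ChaeShvydkoy2013 §2.2]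
-/

noncomputable section

-- flat `Theorems/<Route><Decl>…` files of one crux share the namespace of the crux (tree convention: `Summit.<S>.<S>.…`)
set_option linter.dupNamespace false

open MeasureTheory Set Filter Topology Metric Function TopologicalSpace
open scoped ENNReal NNReal InnerProductSpace RealInnerProductSpace Laplacian

namespace Summit.NavierStokesRegularity.NavierStokesRegularity.Theorems.PowerGaugeEulerLiouville

open Literature.Analysis Literature.Analysis.FunctionSpaces Literature.Analysis.FluidPDE

namespace SlowClock

variable {ρ g T T₁ : ℝ} {x₀ : EuclideanSpace ℝ (Fin 3)}
  {u : ℝ → EuclideanSpace ℝ (Fin 3) → EuclideanSpace ℝ (Fin 3)} {p : ℝ → EuclideanSpace ℝ (Fin 3) → ℝ}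
  {H : ℝ → EuclideanSpace ℝ (Fin 3) → EuclideanSpace ℝ (Fin 3) →L[ℝ] EuclideanSpace ℝ (Fin 3)} {c : ℝ≥0}
  {W : EuclideanSpace ℝ (Fin 3) → EuclideanSpace ℝ (Fin 3)} {P : EuclideanSpace ℝ (Fin 3) → ℝ}

/-! ### The class-`ρ` large-scale profile data of a past-exact member of any rate `g ∈ [0, ½]` -/

/-- **The profile data of a PAST-EXACT member of ANY RATE `g ∈ [0, ½]`** (crux hypotheses verbatim, `0 < ρ ≤ ½`; `(u, p)` exactly self-similar about
`(T, x₀)` at rate `g` for `τ < T₁`, `T₁ ≤ 0`, `T₁ ≤ T`): a profile gradient `G` and ONE constant `c'` with the CLASS-`ρ` shapes (A₁), (E₁), (D₁) for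
`L ≥ 1`, the weak Poisson equation, and the profile local energy equality at the LITERAL rate `g`:
`(2 − 5g)∫σ|W|² = ∫(|W|²+2P)⟪W,∇σ⟫ + g∫|W|²⟪x,∇σ⟫`.  (`exists_locData_past_slow` is the case `0 < g < 2/5` with the rate written `1/(2+ρ')`.) [folklore] -/
theorem exists_locData_past_rate (hρ : 0 < ρ) (hρh : ρ ≤ 1 / 2) (hT₁ : T₁ ≤ 0) (hTT₁ : T₁ ≤ T) (x₀ : EuclideanSpace ℝ (Fin 3))
    (hsw : IsSuitableWeakSolutionOn (slab (EuclideanSpace ℝ (Fin 3)) (Iio 0) isOpen_Iio) 0 0 u p)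
    (hH : HasWeakSpatialGradientOn (slab (EuclideanSpace ℝ (Fin 3)) (Iio 0) isOpen_Iio) u H)
    (hgauge : ∀ a : ℝ, 0 < a →
      ENNReal.ofReal (a ^ (2 * ρ)) * cknA a (0 : ℝ × EuclideanSpace ℝ (Fin 3)) u +
          ENNReal.ofReal (a ^ ρ) * cknE a (0 : ℝ × EuclideanSpace ℝ (Fin 3)) H +
        ENNReal.ofReal (a ^ (2 * ρ)) * cknD a (0 : ℝ × EuclideanSpace ℝ (Fin 3)) p ≤ (c : ℝ≥0∞))
    (hg0 : 0 ≤ g) (hg2 : 2 * g ≤ 1)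
    (hu : ∀ τ : ℝ, τ < T₁ → u τ = fun x => selfSimilarCollapse g T W τ (x - x₀))
    (hp : ∀ τ : ℝ, τ < T₁ → p τ = fun x => selfSimilarCollapsePressure g T P τ (x - x₀)) :
    ∃ (G : EuclideanSpace ℝ (Fin 3) → EuclideanSpace ℝ (Fin 3) →L[ℝ] EuclideanSpace ℝ (Fin 3)) (c' : ℝ≥0),
      AEStronglyMeasurable W volume ∧ AEStronglyMeasurable P volume ∧ AEStronglyMeasurable G volume ∧
      HasWeakFDerivOn (⊤ : Opens (EuclideanSpace ℝ (Fin 3))) volume W G ∧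
      (∀ L : ℝ, 1 ≤ L → ∫⁻ y in ball (0 : EuclideanSpace ℝ (Fin 3)) L, ‖W y‖ₑ ^ 2 ≤
        (c' : ℝ≥0∞) * ENNReal.ofReal (L ^ (1 - 2 * ρ))) ∧
      (∀ L : ℝ, 1 ≤ L →
        ∫⁻ y in ball (0 : EuclideanSpace ℝ (Fin 3)) L, ENNReal.ofReal (frobeniusNormSq (G y)) ≤
          ENNReal.ofReal (L ^ (1 - ρ)) * (ENNReal.ofReal ((1 - ρ) / (2 + ρ)) * (c' : ℝ≥0∞))) ∧
      (∀ L : ℝ, 1 ≤ L →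
        ∫⁻ y in ball (0 : EuclideanSpace ℝ (Fin 3)) L, ‖P y‖ₑ ^ (3 / 2 : ℝ) ≤
          ENNReal.ofReal (L ^ (2 - 2 * ρ)) * (ENNReal.ofReal ((2 - 2 * ρ) / (2 + ρ)) * (c' : ℝ≥0∞))) ∧
      (∀ θ : EuclideanSpace ℝ (Fin 3) → ℝ, ContDiff ℝ (⊤ : ℕ∞) θ → HasCompactSupport θ →
        ∫ y, P y * (Δ θ) y = -∫ y, fderiv ℝ (fderiv ℝ θ) y (W y) (W y)) ∧
      (∀ σ : EuclideanSpace ℝ (Fin 3) → ℝ, IsTestFunctionOn (⊤ : Opens (EuclideanSpace ℝ (Fin 3))) σ →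
        (2 - 5 * g) * ∫ x, σ x * ‖W x‖ ^ 2 =
          (∫ x, (‖W x‖ ^ 2 + 2 * P x) * ⟪W x, gradient σ x⟫) +
            g * ∫ x, ‖W x‖ ^ 2 * ⟪x, gradient σ x⟫) := by
  -- copy of `exists_locData_past_slow` (…SelfSimilarSlowClockPast) with the local energy equality left at the literal rate `g`
  have hρ1 : ρ < 1 := by linarith
  have h2ρ : (0 : ℝ) < 2 + ρ := by linarith
  have hg3 : 3 * g ≤ 2 := by linarith
  -- the three gauges separately
  have hA : ∀ a : ℝ, 0 < a → ENNReal.ofReal (a ^ (2 * ρ)) *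
      cknA a (0 : ℝ × EuclideanSpace ℝ (Fin 3)) u ≤ (c : ℝ≥0∞) :=
    fun a ha => le_trans (le_trans le_self_add le_self_add) (hgauge a ha)
  have hE : ∀ a : ℝ, 0 < a → ENNReal.ofReal (a ^ ρ) *
      cknE a (0 : ℝ × EuclideanSpace ℝ (Fin 3)) H ≤ (c : ℝ≥0∞) :=
    fun a ha => le_trans (le_trans le_add_self le_self_add) (hgauge a ha)
  have hD : ∀ a : ℝ, 0 < a → ENNReal.ofReal (a ^ (2 * ρ)) *
      cknD a (0 : ℝ × EuclideanSpace ℝ (Fin 3)) p ≤ (c : ℝ≥0∞) :=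
    fun a ha => le_trans le_add_self (hgauge a ha)
  -- ### the origin-centred extension: a distributional Euler pair on the whole slab (rate `g`)
  have hsol : IsDistributionalNSSolutionOn (slab (EuclideanSpace ℝ (Fin 3)) (Iio 0) isOpen_Iio) 0 0 u p :=
    hsw.distributional
  have hext := Shifted.isDistributional_selfSimilarCollapse_of_past hT₁ hTT₁ x₀ hsol hu hp
  -- ### measurability
  have hum' : AEStronglyMeasurable (uncurry (selfSimilarCollapse g 0 W))
      (volume.restrict (Iio (0 : ℝ) ×ˢ (univ : Set (EuclideanSpace ℝ (Fin 3))))) := by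
    have := hext.1.aestronglyMeasurable
    simpa [slab] using this
  have hpm' : AEStronglyMeasurable (uncurry (selfSimilarCollapsePressure g 0 P))
      (volume.restrict (Iio (0 : ℝ) ×ˢ (univ : Set (EuclideanSpace ℝ (Fin 3))))) := by
    have := hext.2.2.1.aestronglyMeasurable
    simpa [slab] using this
  have hWm : AEStronglyMeasurable W volume :=
    aestronglyMeasurable_profile (u := selfSimilarCollapse g 0 W) (V := W) hum' fun _ _ => rfl
  have hPm : AEStronglyMeasurable P volume :=
    aestronglyMeasurable_pressureProfile (p := selfSimilarCollapsePressure g 0 P) (P := P) hpm' fun _ _ => rfl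
  have hpm : AEStronglyMeasurable (uncurry p)
      (volume.restrict (Iio (0 : ℝ) ×ˢ (univ : Set (EuclideanSpace ℝ (Fin 3))))) := by
    have := hsol.2.2.1.aestronglyMeasurable
    simpa [slab] using this
  have hHm : AEStronglyMeasurable (uncurry H)
      (volume.restrict (Iio (0 : ℝ) ×ˢ (univ : Set (EuclideanSpace ℝ (Fin 3))))) := by
    have := hH.locallyIntegrableOn_grad.aestronglyMeasurable
    simpa [slab] using this
  -- ### the profile gradient (rate `g`, past form)
  obtain ⟨G, hGm, hWG, hHae⟩ := Past.exists_profileGradient_ae_of_past hH hT₁ hTT₁ x₀ hu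
  -- ### the large-scale gauge data, read at rate `g` in the class-`ρ` shapes
  obtain ⟨CA, hCA, hA''⟩ := OffRate.profile_energy_growth_of_gaugeA_past_rate hρ.le hρh hg0 hT₁ hTT₁ x₀ hu hA
  obtain ⟨CE, hCE, hE''⟩ := profile_gradient_growth_of_gaugeE_past_rate hρ1 hg0 hg3 hT₁ hTT₁ x₀ hHm hHae hE
  obtain ⟨CD, hCD, hD''⟩ := profile_pressure_growth_of_gaugeD_past_rate hρ1 hg0 hg2 hT₁ hTT₁ x₀ hpm hp hD
  -- ### integrability on all balls
  have hV2fin : ∀ r : ℝ, ∫⁻ y in ball (0 : EuclideanSpace ℝ (Fin 3)) r, ‖W y‖ₑ ^ 2 < ⊤ :=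
    Past.lintegral_ball_lt_top_of_growth hCA hA''
  have hGfin : ∀ r : ℝ, ∫⁻ y in ball (0 : EuclideanSpace ℝ (Fin 3)) r, ENNReal.ofReal (frobeniusNormSq (G y)) < ⊤ :=
    Past.lintegral_ball_lt_top_of_growth hCE hE''
  have hPfin : ∀ r : ℝ, ∫⁻ y in ball (0 : EuclideanSpace ℝ (Fin 3)) r, ‖P y‖ₑ ^ (3 / 2 : ℝ) < ⊤ :=
    Past.lintegral_ball_lt_top_of_growth hCD hD''
  have hV2R : ∀ r : ℝ, MemLp W 2 (volume.restrict (ball (0 : EuclideanSpace ℝ (Fin 3)) r)) :=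
    Past.memLp_two_ball_of_lintegral_lt_top hWm hV2fin
  have hG2R : ∀ r : ℝ, MemLp G 2 (volume.restrict (ball (0 : EuclideanSpace ℝ (Fin 3)) r)) :=
    Past.memLp_two_ball_gradient_of_lintegral_lt_top hGm hGfin
  have hP32R : ∀ r : ℝ, MemLp P (3 / 2 : ℝ≥0∞) (volume.restrict (ball (0 : EuclideanSpace ℝ (Fin 3)) r)) :=
    Past.memLp_threeHalves_ball_of_lintegral_lt_top hPm hPfin
  have hV6R : ∀ r : ℝ, MemLp W 6 (volume.restrict (ball (0 : EuclideanSpace ℝ (Fin 3)) r)) :=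
    Past.memLp_six_ball_of_gradient hWm hWG hV2R hGfin
  -- ### local integrability of `W`, `|W|²`, `P`
  have hVloc : LocallyIntegrable W volume := locallyIntegrableOn_univ.1 (by
    simpa only [Opens.coe_top] using hWG.locallyIntegrableOn)
  have hV2loc : LocallyIntegrable (fun y => ‖W y‖ ^ 2) volume := by
    refine (locallyIntegrable_iff).2 fun K hK => ?_
    obtain ⟨r, hr⟩ := hK.isBounded.subset_ball (0 : EuclideanSpace ℝ (Fin 3))
    have h := (hV2R r).integrable_norm_pow two_ne_zero
    exact IntegrableOn.mono_set (show IntegrableOn (fun y => ‖W y‖ ^ 2) (ball 0 r) volume from h) hr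
  have hPloc : LocallyIntegrable P volume := by
    refine (locallyIntegrable_iff).2 fun K hK => ?_
    obtain ⟨r, hr⟩ := hK.isBounded.subset_ball (0 : EuclideanSpace ℝ (Fin 3))
    haveI : IsFiniteMeasure ((volume : Measure (EuclideanSpace ℝ (Fin 3))).restrict
        (ball (0 : EuclideanSpace ℝ (Fin 3)) r)) :=
      isFiniteMeasure_restrict.2 measure_ball_lt_top.ne
    have h : IntegrableOn P (ball (0 : EuclideanSpace ℝ (Fin 3)) r) volume :=
      memLp_one_iff_integrable.1 ((hP32R r).mono_exponent (by
        rw [ENNReal.le_div_iff_mul_le (Or.inl (by norm_num)) (Or.inl (by norm_num))]; norm_num))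
    exact h.mono_set hr
  -- ### the equations at rate `g`, read off the extension
  have heq := fun (ψ : EuclideanSpace ℝ (Fin 3) → EuclideanSpace ℝ (Fin 3))
      (hψ : IsTestFunctionOn (⊤ : Opens (EuclideanSpace ℝ (Fin 3))) ψ) =>
    ProfileEquation.weak_profile_equation hext (fun _ _ => rfl) (fun _ _ => rfl) hVloc hV2loc hPloc hψ
  have hdiv : IsWeaklyDivFree W := ProfileEquation.profile_isWeaklyDivFree hext (fun _ _ => rfl) hVloc
  have hPoisson : ∀ θ : EuclideanSpace ℝ (Fin 3) → ℝ, ContDiff ℝ (⊤ : ℕ∞) θ → HasCompactSupport θ →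
      ∫ y, P y * (Δ θ) y = -∫ y, fderiv ℝ (fderiv ℝ θ) y (W y) (W y) :=
    fun θ hθ hθc => Past.profile_pressure_poisson_of_distributional hext hum' (fun _ _ => rfl) (fun _ _ => rfl)
      hV2loc hPloc hθ hθc
  have hEE := fun (σ : EuclideanSpace ℝ (Fin 3) → ℝ)
      (hσ : IsTestFunctionOn (⊤ : Opens (EuclideanSpace ℝ (Fin 3))) σ) =>
    ProfileEnergy.profile_local_energy_equality hWG hV6R hG2R hPm hP32R hdiv heq hσ
  -- ### thresholds to `L ≥ 1` and ONE common constant in the shapes (A₁), (E₁), (D₁)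
  have hL₀ : (1 : ℝ) ≤ 2 - T₁ := by linarith
  have hA1 := Past.growth_ge_one_of_growth_ge hL₀ (by linarith : (0 : ℝ) ≤ 1 - 2 * ρ) hA''
  have hE1 := Past.growth_ge_one_of_growth_ge hL₀ (by linarith : (0 : ℝ) ≤ 1 - ρ) hE''
  have hD1 := Past.growth_ge_one_of_growth_ge hL₀ (by linarith : (0 : ℝ) ≤ 2 - 2 * ρ) hD''
  set CA' : ℝ≥0∞ := CA * ENNReal.ofReal ((2 - T₁) ^ (1 - 2 * ρ)) with hCA'
  set CE' : ℝ≥0∞ := CE * ENNReal.ofReal ((2 - T₁) ^ (1 - ρ)) with hCE'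
  set CD' : ℝ≥0∞ := CD * ENNReal.ofReal ((2 - T₁) ^ (2 - 2 * ρ)) with hCD'
  have hCA't : CA' ≠ ⊤ := ENNReal.mul_ne_top hCA ENNReal.ofReal_ne_top
  have hCE't : CE' ≠ ⊤ := ENNReal.mul_ne_top hCE ENNReal.ofReal_ne_top
  have hCD't : CD' ≠ ⊤ := ENNReal.mul_ne_top hCD ENNReal.ofReal_ne_top
  set κE : ℝ := (1 - ρ) / (2 + ρ) with hκE
  set κD : ℝ := (2 - 2 * ρ) / (2 + ρ) with hκD
  have hκE0 : 0 < κE := by rw [hκE]; exact div_pos (by linarith) h2ρ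
  have hκD0 : 0 < κD := by rw [hκD]; exact div_pos (by linarith) h2ρ
  set a : ℝ := CA'.toReal with ha
  set e : ℝ := CE'.toReal with he
  set d : ℝ := CD'.toReal with hd
  have ha0 : 0 ≤ a := ENNReal.toReal_nonneg
  have he0 : 0 ≤ e := ENNReal.toReal_nonneg
  have hd0 : 0 ≤ d := ENNReal.toReal_nonneg
  set c₀ : ℝ := a + e / κE + d / κD with hc₀
  have hc₀0 : 0 ≤ c₀ := by positivity
  set c' : ℝ≥0 := c₀.toNNReal with hc'
  have hcc : (c' : ℝ≥0∞) = ENNReal.ofReal c₀ := rfl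
  have haC : CA' = ENNReal.ofReal a := (ENNReal.ofReal_toReal hCA't).symm
  have heC : CE' = ENNReal.ofReal e := (ENNReal.ofReal_toReal hCE't).symm
  have hdC : CD' = ENNReal.ofReal d := (ENNReal.ofReal_toReal hCD't).symm
  have hAle : CA' ≤ (c' : ℝ≥0∞) := by
    rw [haC, hcc]
    refine ENNReal.ofReal_le_ofReal ?_
    have : 0 ≤ e / κE + d / κD := by positivity
    rw [hc₀]; linarith
  have hEle : CE' ≤ ENNReal.ofReal κE * (c' : ℝ≥0∞) := by
    rw [heC, hcc, ← ENNReal.ofReal_mul hκE0.le]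
    refine ENNReal.ofReal_le_ofReal ?_
    have h1 : κE * (e / κE) = e := mul_div_cancel₀ e hκE0.ne'
    have h2 : 0 ≤ κE * a + κE * (d / κD) := by positivity
    rw [hc₀]; nlinarith [h1, h2]
  have hDle : CD' ≤ ENNReal.ofReal κD * (c' : ℝ≥0∞) := by
    rw [hdC, hcc, ← ENNReal.ofReal_mul hκD0.le]
    refine ENNReal.ofReal_le_ofReal ?_
    have h1 : κD * (d / κD) = d := mul_div_cancel₀ d hκD0.ne'
    have h2 : 0 ≤ κD * a + κD * (e / κE) := by positivity
    rw [hc₀]; nlinarith [h1, h2]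
  refine ⟨G, c', hWm, hPm, hGm, hWG, fun L hL => (hA1 L hL).trans (mul_le_mul' hAle le_rfl),
    fun L hL => (hE1 L hL).trans ?_, fun L hL => (hD1 L hL).trans ?_, hPoisson, hEE⟩
  · rw [mul_comm]; exact mul_le_mul' le_rfl hEle
  · rw [mul_comm]; exact mul_le_mul' le_rfl hDle


/-! ### Separable members are trivial -/

/-- **SEPARABLE (RATE-ZERO) MEMBERS ARE TRIVIAL — ansatz form.**  Crux hypotheses verbatim (`0 < ρ ≤ ½`, weak class) + `u τ = selfSimilarCollapse 0 T W τ (· − x₀)`,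
`p τ = selfSimilarCollapsePressure 0 T P τ (· − x₀)` for `τ < T₁` (`T₁ ≤ 0`, `T₁ ≤ T`; i.e. `u = (T−τ)⁻¹ W(x − x₀)`, `p = (T−τ)⁻² P(x − x₀)`) ⇒ `u = 0` a.e.
on `(−∞,0) × ℝ³` — NO hypothesis on the profile. [folklore; cf. ChaeShvydkoy2013 §2.2] -/
theorem separable_ae_eq_zero_past (hρ : 0 < ρ) (hρh : ρ ≤ 1 / 2) (hT₁ : T₁ ≤ 0) (hTT₁ : T₁ ≤ T)
    (x₀ : EuclideanSpace ℝ (Fin 3))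
    (hsw : IsSuitableWeakSolutionOn (slab (EuclideanSpace ℝ (Fin 3)) (Iio 0) isOpen_Iio) 0 0 u p)
    (hH : HasWeakSpatialGradientOn (slab (EuclideanSpace ℝ (Fin 3)) (Iio 0) isOpen_Iio) u H)
    (hgauge : ∀ a : ℝ, 0 < a →
      ENNReal.ofReal (a ^ (2 * ρ)) * cknA a (0 : ℝ × EuclideanSpace ℝ (Fin 3)) u +
          ENNReal.ofReal (a ^ ρ) * cknE a (0 : ℝ × EuclideanSpace ℝ (Fin 3)) H +
        ENNReal.ofReal (a ^ (2 * ρ)) * cknD a (0 : ℝ × EuclideanSpace ℝ (Fin 3)) p ≤ (c : ℝ≥0∞))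
    (hu : ∀ τ : ℝ, τ < T₁ → u τ = fun x => selfSimilarCollapse 0 T W τ (x - x₀))
    (hp : ∀ τ : ℝ, τ < T₁ → p τ = fun x => selfSimilarCollapsePressure 0 T P τ (x - x₀)) :
    uncurry u =ᵐ[volume.restrict (Iio (0 : ℝ) ×ˢ (univ : Set (EuclideanSpace ℝ (Fin 3))))] 0 := by
  have hρ1 : ρ < 1 := by linarith
  obtain ⟨G, c', hWm, hPm, hGm, hWG, hA₁, hE₁, hD₁, hPoisson, hEE⟩ :=
    exists_locData_past_rate hρ hρh hT₁ hTT₁ x₀ hsw hH hgauge le_rfl (by norm_num) hu hp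
  have hW0 : W =ᵐ[volume] 0 :=
    EnergySaturation.ae_eq_zero_of_zeroRate_loc hρ hρ1 hWm hPm hGm hWG hA₁ hE₁ hD₁ hPoisson hEE
  exact Past.ae_eq_zero_of_profile_ae_eq_zero hρ.le hTT₁ hsw hH hgauge hu hW0

/-- **SEPARABLE (RATE-ZERO) MEMBERS ARE TRIVIAL — pointwise form.**  Crux hypotheses verbatim (`0 < ρ ≤ ½`, weak class) +
`u τ x = (T − τ)⁻¹ • W (x − x₀)`, `p τ x = ((T − τ) ^ 2)⁻¹ * P (x − x₀)` for `τ < T₁` (`T₁ ≤ 0`, `T₁ ≤ T`) ⇒ `u = 0` a.e. on `(−∞,0) × ℝ³`.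
[folklore; cf. ChaeShvydkoy2013 §2.2] -/
theorem separable_ae_eq_zero_past' (hρ : 0 < ρ) (hρh : ρ ≤ 1 / 2) (hT₁ : T₁ ≤ 0) (hTT₁ : T₁ ≤ T)
    (x₀ : EuclideanSpace ℝ (Fin 3))
    (hsw : IsSuitableWeakSolutionOn (slab (EuclideanSpace ℝ (Fin 3)) (Iio 0) isOpen_Iio) 0 0 u p)
    (hH : HasWeakSpatialGradientOn (slab (EuclideanSpace ℝ (Fin 3)) (Iio 0) isOpen_Iio) u H)
    (hgauge : ∀ a : ℝ, 0 < a →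
      ENNReal.ofReal (a ^ (2 * ρ)) * cknA a (0 : ℝ × EuclideanSpace ℝ (Fin 3)) u +
          ENNReal.ofReal (a ^ ρ) * cknE a (0 : ℝ × EuclideanSpace ℝ (Fin 3)) H +
        ENNReal.ofReal (a ^ (2 * ρ)) * cknD a (0 : ℝ × EuclideanSpace ℝ (Fin 3)) p ≤ (c : ℝ≥0∞))
    (hu : ∀ τ : ℝ, τ < T₁ → ∀ x, u τ x = (T - τ)⁻¹ • W (x - x₀))
    (hp : ∀ τ : ℝ, τ < T₁ → ∀ x, p τ x = ((T - τ) ^ 2)⁻¹ * P (x - x₀)) :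
    uncurry u =ᵐ[volume.restrict (Iio (0 : ℝ) ×ˢ (univ : Set (EuclideanSpace ℝ (Fin 3))))] 0 := by
  refine separable_ae_eq_zero_past hρ hρh hT₁ hTT₁ x₀ hsw hH hgauge (W := W) (P := P) (fun τ hτ => ?_) (fun τ hτ => ?_)
  · funext x
    have hs : 0 < T - τ := by linarith
    rw [hu τ hτ x, selfSimilarCollapse_apply, neg_zero, Real.rpow_zero, one_smul, zero_sub, Real.rpow_neg_one]
  · funext x
    have hs : 0 < T - τ := by linarith
    rw [hp τ hτ x, selfSimilarCollapsePressure_apply, neg_zero, Real.rpow_zero, one_smul,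
      show (2 : ℝ) * (0 - 1) = -2 by norm_num, Real.rpow_neg hs.le, Real.rpow_two]

end SlowClock

end Summit.NavierStokesRegularity.NavierStokesRegularity.Theorems.PowerGaugeEulerLiouville

end
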